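import Literature.NumberTheory.LFunctions.ClassGroupLFunctionRootNumber
import Literature.NumberTheory.QuadraticFields.IntegralBasisConjugation
import Mathlib.RingTheory.DedekindDomain.Different
import Mathlib.RingTheory.Conductor
import HarnessLib

/-!
# The different of a quadratic field is principal

Topic `Literature/NumberTheory/QuadraticFields` (namespace
`Literature.NumberTheory.QuadraticFields.Quadratic`). Everything here is PROVED; no definitions,
no named facts.

For a quadratic field `K` the maximal order is monogenic, `𝓞_K = ℤ[τ]` (the tree's
`Literature.NumberTheory.QuadraticFields.Quadratic.TauData`: a `ℤ`-basis `(1, τ)` with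
`τ² = ετ + m`), so the conductor of `ℤ[τ]` is `(1)` and Mathlib's
`conductor_mul_differentIdeal` (`𝔣 · 𝔇_{B/A} = (f′(τ))`, Neukirch III (2.4)–(2.5)) gives
`𝔇_{K/ℚ} = (f′(τ)) = (2τ − ε) = (√d_K)` — a PRINCIPAL ideal
(`differentIdeal_int_eq_span`, `differentIdeal_int_isPrincipal`). Consequently the ideal class
of the different, the tree's `Literature.NumberTheory.LFunctions.NumberField.differentClass K`
(the root-number class `W(ψ) = ψ([𝔡_K])` of the functional equation of class group
`L`-functions, `completedClassGroupLFunction_one_sub`), is trivial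
(`differentClass_eq_one`), i.e. every class group character of a quadratic field has root
number `1`. The last statement is packaged in the registered shape of stub S5
`stub_differentClass_eq_one` of the Conrey–Iwaniec Proposition 8.1 line
(`differentClass_eq_one_of_finrank_eq_two`).

## References

* J. Neukirch, *Algebraic Number Theory*, Springer 1999, Ch. III, Prop. (2.4) and (2.5)
  (`𝔇 = (f′(α))` for a monogenic extension), Ch. VII (8.6) (root number `χ(𝔡)`).
  [NeukirchANT1999]
-/

noncomputable section

open scoped NumberField nonZeroDivisors
open Module NumberField Polynomial

namespace Literature.NumberTheory.QuadraticFields.Quadratic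

variable {K : Type*} [Field K] [NumberField K]

namespace TauData

variable (T : TauData K)

omit [NumberField K] in
/-- `𝓞_K = ℤ[τ]`: the subalgebra generated by `τ` is everything (the oriented quadratic ring
`ℤ + ℤτ` is a ring, i.e. `ℤ[τ]`). [cite: BhargavaVarma2016, §2.1 (the oriented quadratic ring ℤ + ℤτ, τ² = ετ + (D − ε)/4)] -/
theorem adjoin_τ_eq_top : Algebra.adjoin ℤ {T.τ} = ⊤ := by
  refine eq_top_iff.2 fun x _ => ?_
  obtain ⟨u, v, hx⟩ := T.exists_int_coords x
  rw [hx]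
  exact add_mem (intCast_mem _ u)
    (mul_mem (intCast_mem _ v) (Algebra.self_mem_adjoin_singleton ℤ T.τ))

/-- `K = ℚ(τ)`: the `ℚ`-subalgebra of `K` generated by `τ` is everything (every `z ∈ K` is
`(u + vτ)/d` with `u, v, d ∈ ℤ`; `K = ℤ[τ] ⊗ ℚ`). [cite: BhargavaVarma2016, §2.1 (the quadratic algebra K = 𝒪 ⊗ ℚ of the oriented quadratic ring ℤ + ℤτ)] -/
theorem adjoin_rat_τ_eq_top : Algebra.adjoin ℚ {((T.τ : 𝓞 K) : K)} = ⊤ := by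
  refine eq_top_iff.2 fun z _ => ?_
  -- clear denominators: `d • z ∈ 𝓞 K` for some nonzero integer `d`
  haveI : Algebra.IsAlgebraic ℤ ℚ := IsLocalization.isAlgebraic ℚ (nonZeroDivisors ℤ)
  haveI : Algebra.IsAlgebraic ℤ K := Algebra.IsAlgebraic.trans ℤ ℚ K
  obtain ⟨d, hd, hint⟩ := (Algebra.IsAlgebraic.isAlgebraic (R := ℤ) z).exists_integral_multiple
  obtain ⟨u, v, huv⟩ := T.exists_int_coords ⟨d • z, hint⟩
  have hcoe : (d : K) * z = u + v * ((T.τ : 𝓞 K) : K) := by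
    have := congrArg (fun x : 𝓞 K => (x : K)) huv
    simpa [zsmul_eq_mul] using this
  have hd' : (d : K) ≠ 0 := by exact_mod_cast hd
  have hz' : z = (u / d : ℚ) • (1 : K) + (v / d : ℚ) • ((T.τ : 𝓞 K) : K) := by
    rw [Rat.smul_def, Rat.smul_def]
    push_cast
    field_simp
    linear_combination hcoe
  rw [hz']
  exact add_mem (Subalgebra.smul_mem _ (one_mem _) _)
    (Subalgebra.smul_mem _ (Algebra.self_mem_adjoin_singleton ℚ _) _)

/-- **The different of a quadratic field is the principal ideal `(f′(τ))`**, `f` the minimal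
polynomial of the generator `τ` of `𝓞_K = ℤ[τ]` (Mathlib's `conductor_mul_differentIdeal` with
conductor `(1)`). [cite: NeukirchANT1999, Ch. III, Prop. (2.4)] -/
theorem differentIdeal_int_eq_span :
    differentIdeal ℤ (𝓞 K) = Ideal.span {aeval T.τ (derivative (minpoly ℤ T.τ))} := by
  have h := conductor_mul_differentIdeal ℤ ℚ K T.τ T.adjoin_rat_τ_eq_top
  rwa [conductor_eq_top_of_adjoin_eq_top T.adjoin_τ_eq_top, Ideal.top_mul] at h

end TauData

/-- **The different of a quadratic field is principal.** [cite: NeukirchANT1999, Ch. III, Prop. (2.4)] -/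
theorem differentIdeal_int_isPrincipal (h2 : finrank ℚ K = 2) :
    (differentIdeal ℤ (𝓞 K)).IsPrincipal := by
  obtain ⟨T⟩ := nonempty_tauData h2
  exact ⟨⟨aeval T.τ (derivative (minpoly ℤ T.τ)), T.differentIdeal_int_eq_span⟩⟩

/-- **The root-number class of a quadratic field is trivial**: `[𝔡_K] = 1` in `Cl_K`, so every
class group character `ψ` of a quadratic field has root number `W(ψ) = ψ([𝔡_K]) = 1` in the
functional equation `Λ(1 − s, ψ) = ψ([𝔡_K]) Λ(s, ψ⁻¹)` (tree
`completedClassGroupLFunction_one_sub`). [cite: NeukirchANT1999, Ch. VII (8.6)] -/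
theorem differentClass_eq_one (h2 : finrank ℚ K = 2) :
    Literature.NumberTheory.LFunctions.NumberField.differentClass K = 1 := by
  rw [Literature.NumberTheory.LFunctions.NumberField.differentClass, ClassGroup.mk0_eq_one_iff]
  exact differentIdeal_int_isPrincipal h2

/-- The same in the registered shape of stub S5 `stub_differentClass_eq_one` of the
Conrey–Iwaniec (2002) Proposition 8.1 line `prop81-afe-plancherel` (quantified over
`K : Type`). [cite: NeukirchANT1999, Ch. VII (8.6)] -/
theorem differentClass_eq_one_of_finrank_eq_two :
    ∀ (K : Type) [Field K] [NumberField K], Module.finrank ℚ K = 2 →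
      Literature.NumberTheory.LFunctions.NumberField.differentClass K = 1 :=
  fun _ _ _ h2 => differentClass_eq_one h2

end Literature.NumberTheory.QuadraticFields.Quadratic
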